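import Literature.NumberTheory.Automorphic.MirabolicTower
import Literature.NumberTheory.Automorphic.UnipotentColumnRangeHaar
import HarnessLib

/-!
# The Whittaker tower of a function on `GL_n(𝔸_K)`: column transforms `T_c`, the partial Whittaker
transforms `Φ_d = T_{d+1} ⋯ T_{n-1} φ`, and their invariance and equivariance

Topic `NumberTheory/Automorphic`; namespace `Literature.NumberTheory.Automorphic`. For a function
`φ : GL_n(𝔸_K) → ℂ` (left `GL_n(K)`-invariant in the applications) and Tate's character `ψ`, the
**column transform along the column `c`** (`1 ≤ c < n`) is

  `T_c f (g) = μ_c(box_c)⁻¹ ∫_{box_c} f(y g) conj ψ(y_{c-1,c}) dμ_c(y)`,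

`Y_c = U_{[c,c]}` the column group, `μ_c` a Haar measure of `Y_c(𝔸_K)`, `box_c` its Tate box
(`colRangeTateDomain`; the value does not depend on the Haar measure, nor — for `Y_c(K)`-invariant
integrands — on the fundamental domain). The **partial Whittaker transform at depth `d`** is
`Φ_d = T_{d+1} (T_{d+2} ( ⋯ (T_{n-1} φ)))`: `Φ_{n-1} = φ`, and `Φ_0 = W_φ` is the global `ψ`-Whittaker
coefficient (Cogdell (2004), §1.1: `W_φ(g) = ∫_{N(k)\N(𝔸)} φ(ng) ψ⁻¹(n) dn`, computed column by column).
This file sets up the transforms and proves (everything for an arbitrary `φ`, continuity assumed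
where needed):

* `continuous_colTransform`, `continuous_whittakerDepth` — continuity of `T_c f` and of the `Φ_d`
  (dominated convergence: jointly continuous integrand, box of compact closure and finite measure);
* `setIntegral_box_comp_colRangeConj`, `setIntegral_box_mul_normalizer_eq` — **moving a rational
  normaliser of `Y_c` through the column integral** ("`γ⁻¹ y γ`, the measure is preserved",
  Cogdell (2004), §2.3): change of variables by the measure-preserving conjugation
  (`UnipotentColumnRangeHaar`) and independence of the fundamental domain for `Y_c(K)`-invariant
  integrands;
* `whittakerIter_mul_left_of_mem` / `whittakerDepth_mul_left_of_mem` — **`Φ_d` is left-invariant under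
  the rational points of `P_{d+1} = Q_d ⊓ GL_{d+1}`**, the mirabolic of the corner, for `φ` left
  `GL_n(K)`-invariant, by induction on the number of integrated columns (loc. cit., proof of Thm. 1.1:
  `y p = p (p⁻¹ y p)` and `ψ((p⁻¹ y p)_{c-1,c}) = ψ(y_{c-1,c})` because the row `c-1` of `p⁻¹ ∈ P_c` is
  `e_{c-1}` and the column `c` of `p` is `e_c`).

The `(U, ψ_N)`-equivariance of the `Φ_d` and the inequality chain are in the sequel.

## References

* J. W. Cogdell, *Analytic theory of L-functions for GL_n*, in *An Introduction to the Langlands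
  Program* (2004), §1.1, Thm. 1.1 and its proof [CogdellAnalyticTheory2004].
* H. Jacquet, J. A. Shalika, *On Euler products and the classification of automorphic
  representations I*, Amer. J. Math. 103 (1981), §4 [JacquetShalikaAJM1981].
-/

noncomputable section

open MeasureTheory Measure NumberField IsDedekindDomain Matrix Set Filter Topology
open scoped MatrixGroups ENNReal NNReal ComplexConjugate

namespace Literature.NumberTheory.Automorphic

section Transform

variable {n : ℕ} {K : Type} [Field K] [NumberField K]
variable [MeasurableSpace (GL (Fin n) (AdeleRing (𝓞 K) K))] [BorelSpace (GL (Fin n) (AdeleRing (𝓞 K) K))]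

/-- **The column transform `T_c f`** along the column `c` (`hc : c < n`, `hc0 : 0 < c`): the normalised
integral of `y ↦ f(y g) conj ψ(y_{c-1,c})` over the Tate box of `Y_c(𝔸_K)` for the Haar measure
`Measure.haar` (Cogdell (2004), §1.1, one column of `∫_{N(k)\N(𝔸)} φ(ng) ψ⁻¹(n) dn`). [folklore] -/
def colTransform (c : ℕ) (hc : c < n) (hc0 : 0 < c) (f : GL (Fin n) (AdeleRing (𝓞 K) K) → ℂ)
    (g : GL (Fin n) (AdeleRing (𝓞 K) K)) : ℂ :=
  ((Measure.haar (G := ↥(adelicColRange n K c c))) (colRangeTateDomain n K c c)).toReal⁻¹ •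
    ∫ y in colRangeTateDomain n K c c,
      f ((y : GL (Fin n) (AdeleRing (𝓞 K) K)) * g) *
        conj (adeleAddChar K (((y : GL (Fin n) (AdeleRing (𝓞 K) K)) : Matrix (Fin n) (Fin n) (AdeleRing (𝓞 K) K))
          ⟨c - 1, by omega⟩ ⟨c, hc⟩) : ℂ)
      ∂(Measure.haar (G := ↥(adelicColRange n K c c)))

/-- **The partial Whittaker transform at depth `d`**: `Φ_d = T_{d+1} (T_{d+2} (⋯ (T_{n-1} φ)))`, defined
by recursion on the number `k` of columns already integrated (`d = n - 1 - k`); `Φ_{n-1} = φ` and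
`Φ_0 = W_φ`. We index by `k`: `whittakerIter k φ` integrates the columns `n-1, n-2, …, n-k`. [folklore] -/
def whittakerIter : ℕ → (GL (Fin n) (AdeleRing (𝓞 K) K) → ℂ) → (GL (Fin n) (AdeleRing (𝓞 K) K) → ℂ)
  | 0, φ => φ
  | k + 1, φ => fun g =>
      if h : n - (k + 1) < n ∧ 0 < n - (k + 1) then
        colTransform (n - (k + 1)) h.1 h.2 (whittakerIter k φ) g
      else whittakerIter k φ g

/-- `Φ_d := whittakerIter (n - 1 - d) φ` — the transform at depth `d` (columns `> d` integrated).
[folklore] -/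
def whittakerDepth (d : ℕ) (φ : GL (Fin n) (AdeleRing (𝓞 K) K) → ℂ) :
    GL (Fin n) (AdeleRing (𝓞 K) K) → ℂ :=
  whittakerIter (n - 1 - d) φ

/-- `Φ_{n-1} = φ`. [folklore] -/
theorem whittakerDepth_top (φ : GL (Fin n) (AdeleRing (𝓞 K) K) → ℂ) : whittakerDepth (n - 1) φ = φ := by
  simp [whittakerDepth, whittakerIter]

/-- **The recursion**: `Φ_{d-1} = T_d Φ_d` for `1 ≤ d < n`. [folklore] -/
theorem whittakerDepth_pred {d : ℕ} (hd : 0 < d) (hdn : d < n) (φ : GL (Fin n) (AdeleRing (𝓞 K) K) → ℂ) :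
    whittakerDepth (d - 1) φ = colTransform d hdn hd (whittakerDepth d φ) := by
  have hk : n - 1 - (d - 1) = (n - 1 - d) + 1 := by omega
  unfold whittakerDepth
  rw [hk]
  funext g
  have h1 : n - (n - 1 - d + 1) = d := by omega
  simp only [whittakerIter, h1]
  rw [dif_pos ⟨hdn, hd⟩]

/-- The integrand of the column transform. [folklore] -/
def colIntegrand (c : ℕ) (hc : c < n) (hc0 : 0 < c) (f : GL (Fin n) (AdeleRing (𝓞 K) K) → ℂ)
    (g : GL (Fin n) (AdeleRing (𝓞 K) K)) (y : ↥(adelicColRange n K c c)) : ℂ :=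
  f ((y : GL (Fin n) (AdeleRing (𝓞 K) K)) * g) *
    conj (adeleAddChar K (((y : GL (Fin n) (AdeleRing (𝓞 K) K)) : Matrix (Fin n) (Fin n) (AdeleRing (𝓞 K) K))
      ⟨c - 1, by omega⟩ ⟨c, hc⟩) : ℂ)

/-- `colTransform` in terms of `colIntegrand` (definitional). [folklore] -/
theorem colTransform_eq (c : ℕ) (hc : c < n) (hc0 : 0 < c) (f : GL (Fin n) (AdeleRing (𝓞 K) K) → ℂ)
    (g : GL (Fin n) (AdeleRing (𝓞 K) K)) :
    colTransform c hc hc0 f g =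
      ((Measure.haar (G := ↥(adelicColRange n K c c))) (colRangeTateDomain n K c c)).toReal⁻¹ •
        ∫ y in colRangeTateDomain n K c c, colIntegrand c hc hc0 f g y
          ∂(Measure.haar (G := ↥(adelicColRange n K c c))) := rfl

omit [MeasurableSpace (GL (Fin n) (AdeleRing (𝓞 K) K))] [BorelSpace (GL (Fin n) (AdeleRing (𝓞 K) K))] in
/-- The character factor `y ↦ conj ψ(y_{c-1,c})` is continuous. [folklore] -/
theorem continuous_colCharFactor (c : ℕ) (hc : c < n) (hc0 : 0 < c) :
    Continuous fun y : ↥(adelicColRange n K c c) =>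
      conj (adeleAddChar K (((y : GL (Fin n) (AdeleRing (𝓞 K) K)) : Matrix (Fin n) (Fin n) (AdeleRing (𝓞 K) K))
        ⟨c - 1, by omega⟩ ⟨c, hc⟩) : ℂ) :=
  Complex.continuous_conj.comp (continuous_subtype_val.comp
    ((continuous_adeleAddChar K).comp (continuous_adelicColRange_apply _ _)))

omit [MeasurableSpace (GL (Fin n) (AdeleRing (𝓞 K) K))] [BorelSpace (GL (Fin n) (AdeleRing (𝓞 K) K))] in
/-- The character factor has norm `1`. [folklore] -/
theorem norm_colCharFactor (c : ℕ) (hc : c < n) (hc0 : 0 < c) (y : ↥(adelicColRange n K c c)) :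
    ‖(conj (adeleAddChar K (((y : GL (Fin n) (AdeleRing (𝓞 K) K)) : Matrix (Fin n) (Fin n) (AdeleRing (𝓞 K) K))
        ⟨c - 1, by omega⟩ ⟨c, hc⟩) : ℂ) : ℂ)‖ = 1 := by
  rw [Complex.norm_conj, Circle.norm_coe]

omit [MeasurableSpace (GL (Fin n) (AdeleRing (𝓞 K) K))] [BorelSpace (GL (Fin n) (AdeleRing (𝓞 K) K))] in
/-- The integrand is jointly continuous for continuous `f`. [folklore] -/
theorem continuous_colIntegrand_uncurry (c : ℕ) (hc : c < n) (hc0 : 0 < c)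
    {f : GL (Fin n) (AdeleRing (𝓞 K) K) → ℂ} (hf : Continuous f) :
    Continuous fun p : GL (Fin n) (AdeleRing (𝓞 K) K) × ↥(adelicColRange n K c c) =>
      colIntegrand c hc hc0 f p.1 p.2 := by
  unfold colIntegrand
  exact (hf.comp ((continuous_subtype_val.comp continuous_snd).mul continuous_fst)).mul
    ((continuous_colCharFactor c hc hc0).comp continuous_snd)

/-- **The column transform of a continuous function is continuous** (dominated convergence: the
integrand is jointly continuous, the box has compact closure and finite measure, so on a compact
neighbourhood of `g₀` the integrand is uniformly bounded). [folklore] -/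
theorem continuous_colTransform (c : ℕ) (hc : c < n) (hc0 : 0 < c)
    {f : GL (Fin n) (AdeleRing (𝓞 K) K) → ℂ} (hf : Continuous f) :
    Continuous (colTransform (K := K) c hc hc0 f) := by
  haveI := AdelicGroupData.locallyCompactSpace_generalLinearGroup_adeleRing K (Fin n)
  haveI := secondCountableTopology_generalLinearGroup_adeleRing K (Fin n)
  set Y := adelicColRange n K c c
  set μ : Measure ↥Y := Measure.haar with hμ
  set box := colRangeTateDomain n K c c with hbox
  have hboxm : MeasurableSet box := measurableSet_colRangeTateDomain
  have hboxfin : μ box < ⊤ := measure_colRangeTateDomain_lt_top μ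
  haveI : IsFiniteMeasure (μ.restrict box) := isFiniteMeasure_restrict.2 hboxfin.ne
  have hjoint := continuous_colIntegrand_uncurry c hc hc0 hf
  suffices h : Continuous fun g => ∫ y in box, colIntegrand c hc hc0 f g y ∂μ by
    have e : colTransform (K := K) c hc hc0 f =
        fun g => (μ box).toReal⁻¹ • ∫ y in box, colIntegrand c hc hc0 f g y ∂μ := rfl
    rw [e]
    exact h.const_smul ((μ box).toReal⁻¹)
  refine continuous_iff_continuousAt.2 fun g₀ => ?_
  -- a compact neighbourhood of `g₀` and a uniform bound there
  obtain ⟨V, hVc, hVn⟩ := exists_compact_mem_nhds g₀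
  set C : Set (GL (Fin n) (AdeleRing (𝓞 K) K)) :=
    (fun p : ↥Y × GL (Fin n) (AdeleRing (𝓞 K) K) => (p.1 : GL (Fin n) (AdeleRing (𝓞 K) K)) * p.2) ''
      (closure box ×ˢ V) with hC
  have hCc : IsCompact C :=
    (isCompact_closure_colRangeTateDomain.prod hVc).image
      ((continuous_subtype_val.comp continuous_fst).mul continuous_snd)
  obtain ⟨M, hM⟩ := hCc.exists_bound_of_continuousOn hf.continuousOn
  refine continuousAt_of_dominated (bound := fun _ => max M 0) ?_ ?_ (integrable_const _) ?_
  · exact Eventually.of_forall fun g =>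
      (hjoint.comp (Continuous.prodMk continuous_const continuous_id)).aestronglyMeasurable
  · filter_upwards [hVn] with g hg
    rw [ae_restrict_iff' hboxm]
    refine Eventually.of_forall fun y hy => ?_
    unfold colIntegrand
    rw [norm_mul, norm_colCharFactor c hc hc0, mul_one]
    refine (hM _ ⟨(y, g), ⟨subset_closure hy, hg⟩, rfl⟩).trans (le_max_left _ _)
  · exact Eventually.of_forall fun y =>
      (hjoint.comp (Continuous.prodMk continuous_id continuous_const)).continuousAt

/-- **The partial Whittaker transforms of a continuous function are continuous.** [folklore] -/
theorem continuous_whittakerIter {φ : GL (Fin n) (AdeleRing (𝓞 K) K) → ℂ} (hφ : Continuous φ) :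
    ∀ k, Continuous (whittakerIter (K := K) k φ)
  | 0 => hφ
  | k + 1 => by
    by_cases h : n - (k + 1) < n ∧ 0 < n - (k + 1)
    · have hc := continuous_colTransform (n - (k + 1)) h.1 h.2 (continuous_whittakerIter hφ k)
      have : whittakerIter (K := K) (k + 1) φ = colTransform (n - (k + 1)) h.1 h.2 (whittakerIter k φ) := by
        funext g; simp only [whittakerIter, dif_pos h]
      rw [this]; exact hc
    · have : whittakerIter (K := K) (k + 1) φ = whittakerIter k φ := by
        funext g; simp only [whittakerIter, dif_neg h]
      rw [this]; exact continuous_whittakerIter hφ k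

/-- Continuity of `Φ_d`. [folklore] -/
theorem continuous_whittakerDepth {φ : GL (Fin n) (AdeleRing (𝓞 K) K) → ℂ} (hφ : Continuous φ) (d : ℕ) :
    Continuous (whittakerDepth (K := K) d φ) :=
  continuous_whittakerIter hφ _

/-! ### Moving a rational normaliser through the column integral -/

/-- **Integrals over the box of conjugated invariant functions.** For a Haar measure `ν` of
`Y = U_{[a,b]}(𝔸_K)`, a normaliser `g` of `Y` preserving the lattice `Y(K)`, and `F` invariant under left
multiplication by `Y(K)`: `∫_{box} F(g y g⁻¹) dν = ∫_{box} F dν` (change of variables by the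
measure-preserving conjugation, then independence of the fundamental domain). [folklore] -/
theorem setIntegral_box_comp_colRangeConj {a b : ℕ} (g : GL (Fin n) (AdeleRing (𝓞 K) K))
    (hg : ∀ u : GL (Fin n) (AdeleRing (𝓞 K) K), u ∈ adelicColRange n K a b ↔
      g * u * g⁻¹ ∈ adelicColRange n K a b)
    (hgK : ∀ u : ↥(adelicColRange n K a b), colRangeConj g hg u ∈ rationalColRange n K a b ↔
      u ∈ rationalColRange n K a b)
    (ν : Measure ↥(adelicColRange n K a b)) [IsHaarMeasure ν]
    {E : Type*} [NormedAddCommGroup E] [NormedSpace ℝ E] {F : ↥(adelicColRange n K a b) → E}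
    (hF : ∀ (γ : ↥(rationalColRange n K a b)) (y : ↥(adelicColRange n K a b)), F (γ • y) = F y) :
    ∫ y in colRangeTateDomain n K a b, F (colRangeConj g hg y) ∂ν =
      ∫ y in colRangeTateDomain n K a b, F y ∂ν := by
  rw [setIntegral_colRangeConj_eq g hg hgK ν F]
  exact (isFundamentalDomain_image_colRangeConj g hg hgK ν).setIntegral_eq
    (isFundamentalDomain_colRangeTateDomain ν) hF

/-- **Moving a rational normaliser through the column integral.** Let `s = s₀ ∈ GL_n(K)` (diagonally
embedded) normalise `Y_c(𝔸_K)`, let `f` be left `s`-invariant, and let `χ, χ'` be twists related by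
`χ(y) = χ'(s⁻¹ y s)` such that `y ↦ f(y g) χ'(y)` is `Y_c(K)`-invariant. Then
`∫_{box} f(y s g) χ(y) dy = ∫_{box} f(y g) χ'(y) dy`: write `y s = s (s⁻¹ y s)`, drop the `s`, change
variables by the measure-preserving conjugation and move the fundamental domain back. This is the
manipulation "`γ⁻¹ y γ`, the measure is preserved" of every unfolding computation
(Cogdell (2004), §2.3; Jacquet–Shalika (1981), §4). [folklore] -/
theorem setIntegral_box_mul_normalizer_eq {c : ℕ} (ν : Measure ↥(adelicColRange n K c c)) [IsHaarMeasure ν]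
    (s₀ : GL (Fin n) K)
    (hθ : ∀ u : GL (Fin n) (AdeleRing (𝓞 K) K), u ∈ adelicColRange n K c c ↔
      Matrix.GeneralLinearGroup.map (algebraMap K (AdeleRing (𝓞 K) K)) s₀⁻¹ * u *
        (Matrix.GeneralLinearGroup.map (algebraMap K (AdeleRing (𝓞 K) K)) s₀⁻¹)⁻¹ ∈ adelicColRange n K c c)
    {f : GL (Fin n) (AdeleRing (𝓞 K) K) → ℂ}
    (hfs : ∀ x, f (Matrix.GeneralLinearGroup.map (algebraMap K (AdeleRing (𝓞 K) K)) s₀ * x) = f x)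
    {χ χ' : ↥(adelicColRange n K c c) → ℂ}
    (hχ : ∀ y, χ y = χ' (colRangeConj _ hθ y))
    (g : GL (Fin n) (AdeleRing (𝓞 K) K))
    (hF : ∀ (γ : ↥(rationalColRange n K c c)) (y : ↥(adelicColRange n K c c)),
      f (((γ • y : ↥(adelicColRange n K c c)) : GL (Fin n) (AdeleRing (𝓞 K) K)) * g) * χ' (γ • y) =
        f ((y : GL (Fin n) (AdeleRing (𝓞 K) K)) * g) * χ' y) :
    ∫ y in colRangeTateDomain n K c c,
        f ((y : GL (Fin n) (AdeleRing (𝓞 K) K)) *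
          Matrix.GeneralLinearGroup.map (algebraMap K (AdeleRing (𝓞 K) K)) s₀ * g) * χ y ∂ν =
      ∫ y in colRangeTateDomain n K c c, f ((y : GL (Fin n) (AdeleRing (𝓞 K) K)) * g) * χ' y ∂ν := by
  set s := Matrix.GeneralLinearGroup.map (algebraMap K (AdeleRing (𝓞 K) K)) s₀ with hs_def
  have hsinv : Matrix.GeneralLinearGroup.map (algebraMap K (AdeleRing (𝓞 K) K)) s₀⁻¹ = s⁻¹ := map_inv _ _
  -- `f (y s g) = f (s⁻¹ y s g) = f ((θ y) g)`
  have hfs' : ∀ x, f x = f (s⁻¹ * x) := fun x => by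
    have := hfs (s⁻¹ * x); rwa [mul_inv_cancel_left] at this
  have hint : ∀ y : ↥(adelicColRange n K c c),
      f ((y : GL (Fin n) (AdeleRing (𝓞 K) K)) * s * g) * χ y =
        (fun y' : ↥(adelicColRange n K c c) => f ((y' : GL (Fin n) (AdeleRing (𝓞 K) K)) * g) * χ' y')
          (colRangeConj _ hθ y) := by
    intro y
    have hcoe : ((colRangeConj _ hθ y : ↥(adelicColRange n K c c)) : GL (Fin n) (AdeleRing (𝓞 K) K)) =
        s⁻¹ * y * s := by
      rw [coe_colRangeConj_apply, hsinv, inv_inv]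
    change _ = f ((colRangeConj _ hθ y : ↥(adelicColRange n K c c)) * g) * χ' (colRangeConj _ hθ y)
    rw [hcoe, hχ y, hfs' ((y : GL (Fin n) (AdeleRing (𝓞 K) K)) * s * g)]
    congr 2
    simp only [mul_assoc]
  simp_rw [hint]
  exact setIntegral_box_comp_colRangeConj _ hθ (colRangeConj_mem_rationalColRange_iff hθ) ν
    (F := fun y' : ↥(adelicColRange n K c c) => f ((y' : GL (Fin n) (AdeleRing (𝓞 K) K)) * g) * χ' y') hF

/-! ### Matrix lemmas for the invariance -/

section MatrixLemmas

variable {R : Type*} [CommRing R]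

omit [MeasurableSpace (GL (Fin n) (AdeleRing (𝓞 K) K))] [BorelSpace (GL (Fin n) (AdeleRing (𝓞 K) K))] in
/-- The diagonal image of a rational corner element is a corner element. [folklore] -/
theorem map_mem_cornerGL {S : Type*} [CommRing S] (f : R →+* S) {d : ℕ} {p : GL (Fin n) R}
    (hp : p ∈ cornerGL n R d) : Matrix.GeneralLinearGroup.map f p ∈ cornerGL n S d := by
  intro i j hij
  change f ((p : Matrix (Fin n) (Fin n) R) i j) = _
  rw [hp i j hij]
  split_ifs <;> simp

omit [MeasurableSpace (GL (Fin n) (AdeleRing (𝓞 K) K))] [BorelSpace (GL (Fin n) (AdeleRing (𝓞 K) K))] in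
/-- The diagonal image of a rational element of `Q_d` lies in `Q_d`. [folklore] -/
theorem map_mem_tailUnipotent {S : Type*} [CommRing S] (f : R →+* S) {d : ℕ} {p : GL (Fin n) R}
    (hp : p ∈ tailUnipotent n R d) : Matrix.GeneralLinearGroup.map f p ∈ tailUnipotent n S d := by
  intro i j hi hji
  change f ((p : Matrix (Fin n) (Fin n) R) i j) = _
  rw [hp i j hi hji]
  split_ifs <;> simp

omit [MeasurableSpace (GL (Fin n) (AdeleRing (𝓞 K) K))] [BorelSpace (GL (Fin n) (AdeleRing (𝓞 K) K))] in
/-- **The row `c - 1` of an element of `P_c = Q_{c-1} ⊓ GL_c` is `e_{c-1}`.** [folklore] -/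
theorem row_pred_eq_of_mem_mirabolicCorner {c : ℕ} (hc : c < n) (hc0 : 0 < c) {p : GL (Fin n) R}
    (hp : p ∈ tailUnipotent n R (c - 1)) (hpc : p ∈ cornerGL n R c) (a : Fin n) :
    (p : Matrix (Fin n) (Fin n) R) ⟨c - 1, by omega⟩ a = if (⟨c - 1, by omega⟩ : Fin n) = a then 1 else 0 := by
  by_cases ha : (a : ℕ) ≤ c - 1
  · exact hp _ a (by simp) (Fin.le_def.2 (by simpa using ha))
  · exact hpc _ a (Or.inr (by omega))

omit [MeasurableSpace (GL (Fin n) (AdeleRing (𝓞 K) K))] [BorelSpace (GL (Fin n) (AdeleRing (𝓞 K) K))] in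
/-- **Conjugation by `P_c` does not change the entry `(c-1, c)`**: `(q M p)_{c-1,c} = M_{c-1,c}` for
`q, p ∈ P_c` (the row `c-1` of `q` is `e_{c-1}` and the column `c` of `p` is `e_c`). [folklore] -/
theorem conj_apply_pred_eq {c : ℕ} (hc : c < n) (hc0 : 0 < c) {p q : GL (Fin n) R}
    (hq : q ∈ tailUnipotent n R (c - 1)) (hqc : q ∈ cornerGL n R c) (hpc : p ∈ cornerGL n R c)
    (M : Matrix (Fin n) (Fin n) R) :
    ((q : Matrix (Fin n) (Fin n) R) * M * (p : Matrix (Fin n) (Fin n) R)) ⟨c - 1, by omega⟩ ⟨c, hc⟩ =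
      M ⟨c - 1, by omega⟩ ⟨c, hc⟩ := by
  rw [Matrix.mul_apply]
  have hcol : ∀ b : Fin n, (p : Matrix (Fin n) (Fin n) R) b ⟨c, hc⟩ = if b = ⟨c, hc⟩ then 1 else 0 :=
    fun b => hpc b _ (Or.inr (by simp))
  simp only [hcol, mul_ite, mul_one, mul_zero, Finset.sum_ite_eq', Finset.mem_univ, if_true]
  rw [Matrix.mul_apply]
  simp only [row_pred_eq_of_mem_mirabolicCorner hc hc0 hq hqc, ite_mul, one_mul, zero_mul,
    Finset.sum_ite_eq, Finset.mem_univ, if_true]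

omit [MeasurableSpace (GL (Fin n) (AdeleRing (𝓞 K) K))] [BorelSpace (GL (Fin n) (AdeleRing (𝓞 K) K))] in
/-- **The entry `(c-1, c)` is additive on `N_n`**: `(γ u)_{c-1,c} = u_{c-1,c} + γ_{c-1,c}` for unitriangular
`γ, u` (no index strictly between `c - 1` and `c`). [folklore] -/
theorem unitriangular_mul_apply_pred {c : ℕ} (hc : c < n) (hc0 : 0 < c) {γ u : GL (Fin n) R}
    (hγ : γ ∈ upperUnitriangular (Fin n) R) (hu : u ∈ upperUnitriangular (Fin n) R) :
    ((γ * u : GL (Fin n) R) : Matrix (Fin n) (Fin n) R) ⟨c - 1, by omega⟩ ⟨c, hc⟩ =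
      (u : Matrix (Fin n) (Fin n) R) ⟨c - 1, by omega⟩ ⟨c, hc⟩ +
        (γ : Matrix (Fin n) (Fin n) R) ⟨c - 1, by omega⟩ ⟨c, hc⟩ := by
  obtain ⟨hγt, hγd⟩ := (mem_upperUnitriangular_iff γ).1 hγ
  obtain ⟨hut, hud⟩ := (mem_upperUnitriangular_iff u).1 hu
  have hlt : (⟨c - 1, by omega⟩ : Fin n) < ⟨c, hc⟩ := Fin.lt_def.2 (by simp; omega)
  rw [Units.val_mul, unitriangular_mul_apply_of_lt hγt hγd hut hud hlt, Finset.sum_eq_zero, add_zero]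
  intro k hk
  simp only [Finset.mem_filter, Finset.mem_univ, true_and] at hk
  exfalso
  have h1 := Fin.lt_def.1 hk.1
  have h2 := Fin.lt_def.1 hk.2
  simp at h1 h2
  omega

omit [MeasurableSpace (GL (Fin n) (AdeleRing (𝓞 K) K))] [BorelSpace (GL (Fin n) (AdeleRing (𝓞 K) K))] in
/-- **The column group `Y_c = U_{[c,c]}` lies in the corner `GL_{c+1}`.** [folklore] -/
theorem unipotentColRange_le_cornerGL_succ (c : ℕ) : unipotentColRange n R c c ≤ cornerGL n R (c + 1) := by
  intro u hu i j hij
  rcases hij with hi | hj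
  · by_cases hji : j ≤ i
    · exact apply_of_le hu hji
    · exact apply_of_not_inColRange hu i fun h => by
        have := Fin.lt_def.1 (lt_of_not_ge hji); have h2 := h.2; omega
  · exact apply_of_not_inColRange hu i fun h => by have h2 := h.2; omega

omit [MeasurableSpace (GL (Fin n) (AdeleRing (𝓞 K) K))] [BorelSpace (GL (Fin n) (AdeleRing (𝓞 K) K))] in
/-- Corner membership descends along an injective ring map. [folklore] -/
theorem mem_cornerGL_of_map_mem {S : Type*} [CommRing S] {f : R →+* S} (hf : Function.Injective f)
    {d : ℕ} {p : GL (Fin n) R} (h : Matrix.GeneralLinearGroup.map f p ∈ cornerGL n S d) :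
    p ∈ cornerGL n R d := by
  intro i j hij
  have h1 := h i j hij
  change f ((p : Matrix (Fin n) (Fin n) R) i j) = _ at h1
  apply hf
  rw [h1]
  split_ifs <;> simp

omit [MeasurableSpace (GL (Fin n) (AdeleRing (𝓞 K) K))] [BorelSpace (GL (Fin n) (AdeleRing (𝓞 K) K))] in
/-- `Q_d` membership descends along an injective ring map. [folklore] -/
theorem mem_tailUnipotent_of_map_mem {S : Type*} [CommRing S] {f : R →+* S} (hf : Function.Injective f)
    {d : ℕ} {p : GL (Fin n) R} (h : Matrix.GeneralLinearGroup.map f p ∈ tailUnipotent n S d) :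
    p ∈ tailUnipotent n R d := by
  intro i j hi hji
  have h1 := h i j hi hji
  change f ((p : Matrix (Fin n) (Fin n) R) i j) = _ at h1
  apply hf
  rw [h1]
  split_ifs <;> simp

end MatrixLemmas

/-! ### Invariance of the partial Whittaker transforms under the rational mirabolic corners -/

/-- **One step**: if `f` is continuous and left-invariant under the rational points of
`P_{c+1} = Q_c ⊓ GL_{c+1}`, then `T_c f` is left-invariant under the rational points of
`P_c = Q_{c-1} ⊓ GL_c` (`1 ≤ c < n`). [folklore] -/
theorem colTransform_mul_left_of_mem (c : ℕ) (hc : c < n) (hc0 : 0 < c)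
    {f : GL (Fin n) (AdeleRing (𝓞 K) K) → ℂ}
    (hf : ∀ q₀ : GL (Fin n) K, q₀ ∈ tailUnipotent n K c → q₀ ∈ cornerGL n K (c + 1) →
      ∀ x, f (Matrix.GeneralLinearGroup.map (algebraMap K (AdeleRing (𝓞 K) K)) q₀ * x) = f x)
    {p₀ : GL (Fin n) K} (hp : p₀ ∈ tailUnipotent n K (c - 1)) (hpc : p₀ ∈ cornerGL n K c)
    (g : GL (Fin n) (AdeleRing (𝓞 K) K)) :
    colTransform c hc hc0 f (Matrix.GeneralLinearGroup.map (algebraMap K (AdeleRing (𝓞 K) K)) p₀ * g) =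
      colTransform c hc hc0 f g := by
  set ι := algebraMap K (AdeleRing (𝓞 K) K) with hι
  -- `p⁻¹` normalises `Y_c(𝔸)` (a corner element)
  have hpinvc : Matrix.GeneralLinearGroup.map ι p₀⁻¹ ∈ cornerGL n (AdeleRing (𝓞 K) K) c :=
    map_mem_cornerGL ι ((cornerGL n K c).inv_mem hpc)
  have hθ : ∀ u : GL (Fin n) (AdeleRing (𝓞 K) K), u ∈ adelicColRange n K c c ↔
      Matrix.GeneralLinearGroup.map ι p₀⁻¹ * u * (Matrix.GeneralLinearGroup.map ι p₀⁻¹)⁻¹ ∈ adelicColRange n K c c := by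
    intro u
    constructor
    · intro hu; exact conj_mem_unipotentColRange_of_mem_cornerGL hpinvc hu
    · intro hu
      have h := conj_mem_unipotentColRange_of_mem_cornerGL ((cornerGL n _ c).inv_mem hpinvc) hu
      simpa [mul_assoc] using h
  -- `f` is `p`-invariant (`P_c ≤ P_{c+1}`)
  have hfp : ∀ x, f (Matrix.GeneralLinearGroup.map ι p₀ * x) = f x :=
    hf p₀ (tailUnipotent_mono (by omega) hp) (cornerGL_mono (by omega) hpc)
  simp only [colTransform_eq]
  congr 1
  -- apply the normaliser lemma with `χ = χ'` the character factor
  have hmain := setIntegral_box_mul_normalizer_eq (Measure.haar) p₀ hθ hfp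
    (χ := fun y => conj (adeleAddChar K (((y : GL (Fin n) (AdeleRing (𝓞 K) K)) : Matrix (Fin n) (Fin n) (AdeleRing (𝓞 K) K))
      ⟨c - 1, by omega⟩ ⟨c, hc⟩) : ℂ))
    (χ' := fun y => conj (adeleAddChar K (((y : GL (Fin n) (AdeleRing (𝓞 K) K)) : Matrix (Fin n) (Fin n) (AdeleRing (𝓞 K) K))
      ⟨c - 1, by omega⟩ ⟨c, hc⟩) : ℂ)) ?_ g ?_
  · simpa only [colIntegrand, mul_assoc] using hmain
  · -- character compatibility: `(p⁻¹ y p)_{c-1,c} = y_{c-1,c}`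
    intro y
    have e3 : (Matrix.GeneralLinearGroup.map ι p₀⁻¹)⁻¹ = Matrix.GeneralLinearGroup.map ι p₀ := by
      rw [map_inv, inv_inv]
    change _ = conj (adeleAddChar K ((((colRangeConj _ hθ y : ↥(adelicColRange n K c c)) :
      GL (Fin n) (AdeleRing (𝓞 K) K)) : Matrix (Fin n) (Fin n) (AdeleRing (𝓞 K) K)) ⟨c - 1, by omega⟩ ⟨c, hc⟩) : ℂ)
    rw [coe_colRangeConj_apply, e3, Units.val_mul, Units.val_mul,
      conj_apply_pred_eq hc hc0 (map_mem_tailUnipotent ι ((tailUnipotent n K (c - 1)).inv_mem hp))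
        (map_mem_cornerGL ι ((cornerGL n K c).inv_mem hpc)) (map_mem_cornerGL ι hpc)]
  · -- `Y_c(K)`-invariance of `y ↦ f (y g) conj χ(y)`
    intro γ y
    obtain ⟨γ₀, hγ₀⟩ := (mem_rationalColRange_iff (γ : ↥(adelicColRange n K c c))).1 γ.2
    have hγA : Matrix.GeneralLinearGroup.map ι γ₀ ∈ adelicColRange n K c c := by
      rw [hγ₀]; exact (γ : ↥(adelicColRange n K c c)).2
    have hinj : Function.Injective ι := NumberField.AdeleRing.algebraMap_injective (𝓞 K) K
    have hγt : γ₀ ∈ tailUnipotent n K c :=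
      mem_tailUnipotent_of_map_mem hinj (unipotentColRange_le_tailUnipotent c c c hγA)
    have hγc : γ₀ ∈ cornerGL n K (c + 1) :=
      mem_cornerGL_of_map_mem hinj (unipotentColRange_le_cornerGL_succ c hγA)
    have hsmul : ((γ • y : ↥(adelicColRange n K c c)) : GL (Fin n) (AdeleRing (𝓞 K) K)) =
        Matrix.GeneralLinearGroup.map ι γ₀ * y := by
      rw [Subgroup.smul_def, smul_eq_mul, Subgroup.coe_mul, ← hγ₀]
    rw [hsmul, mul_assoc, hf γ₀ hγt hγc]
    congr 1
    -- the character factor: `(γ y)_{c-1,c} = y_{c-1,c} + γ_{c-1,c}` and `ψ(γ_{c-1,c}) = 1`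
    have hγN : Matrix.GeneralLinearGroup.map ι γ₀ ∈ upperUnitriangular (Fin n) (AdeleRing (𝓞 K) K) := by
      rw [hγ₀]; exact adelicColRange_le_adelicUnipotent n K c c (γ : ↥(adelicColRange n K c c)).2
    have hyN : (y : GL (Fin n) (AdeleRing (𝓞 K) K)) ∈ upperUnitriangular (Fin n) (AdeleRing (𝓞 K) K) :=
      adelicColRange_le_adelicUnipotent n K c c y.2
    have h := unitriangular_mul_apply_pred hc hc0 hγN hyN
    rw [Units.val_mul] at h ⊢
    rw [h, AddChar.map_add_eq_mul]
    have hγentry : ((Matrix.GeneralLinearGroup.map ι γ₀ : GL (Fin n) (AdeleRing (𝓞 K) K)) : Matrix (Fin n) (Fin n) (AdeleRing (𝓞 K) K))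
        ⟨c - 1, by omega⟩ ⟨c, hc⟩ = ι ((γ₀ : Matrix (Fin n) (Fin n) K) ⟨c - 1, by omega⟩ ⟨c, hc⟩) := rfl
    rw [hγentry, hι, adeleAddChar_algebraMap, mul_one]

/-- **`Φ_d` is left-invariant under the rational points of `P_{d+1} = Q_d ⊓ GL_{d+1}`** for `φ` left
`GL_n(K)`-invariant: in terms of `whittakerIter k` (`d = n - 1 - k`), invariance under
`tailUnipotent (n-1-k) ⊓ cornerGL (n-k)` rational, by induction on `k` (`colTransform_mul_left_of_mem`).
This is the invariance used to unfold along `P_{d} \ P_{d+1}`-cosets in the Fourier–Whittaker recursion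
(Cogdell (2004), proof of Thm. 1.1). [folklore] -/
theorem whittakerIter_mul_left_of_mem {φ : GL (Fin n) (AdeleRing (𝓞 K) K) → ℂ}
    (hφK : ∀ (γ₀ : GL (Fin n) K) (x : GL (Fin n) (AdeleRing (𝓞 K) K)),
      φ (Matrix.GeneralLinearGroup.map (algebraMap K (AdeleRing (𝓞 K) K)) γ₀ * x) = φ x) :
    ∀ (k : ℕ) (q₀ : GL (Fin n) K), q₀ ∈ tailUnipotent n K (n - 1 - k) → q₀ ∈ cornerGL n K (n - k) →
      ∀ x, whittakerIter k φ (Matrix.GeneralLinearGroup.map (algebraMap K (AdeleRing (𝓞 K) K)) q₀ * x) =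
        whittakerIter k φ x
  | 0 => fun q₀ _ _ x => hφK q₀ x
  | k + 1 => by
    intro q₀ hq hqc x
    by_cases h : n - (k + 1) < n ∧ 0 < n - (k + 1)
    · have e : whittakerIter (K := K) (k + 1) φ =
          colTransform (n - (k + 1)) h.1 h.2 (whittakerIter k φ) := by
        funext g; simp only [whittakerIter, dif_pos h]
      rw [e]
      have e1 : n - 1 - k = n - (k + 1) := by omega
      have e2 : n - k = n - (k + 1) + 1 := by omega
      have e3 : n - 1 - (k + 1) = n - (k + 1) - 1 := by omega
      refine colTransform_mul_left_of_mem (n - (k + 1)) h.1 h.2 ?_ ?_ hqc x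
      · intro q hq' hqc' y
        refine whittakerIter_mul_left_of_mem hφK k q ?_ ?_ y
        · rw [e1]; exact hq'
        · rw [e2]; exact hqc'
      · rw [← e3]; exact hq
    · have e : whittakerIter (K := K) (k + 1) φ = whittakerIter k φ := by
        funext g; simp only [whittakerIter, dif_neg h]
      rw [e]
      exact whittakerIter_mul_left_of_mem hφK k q₀ (tailUnipotent_mono (by omega) hq)
        (cornerGL_mono (by omega) hqc) x

/-- The same for `Φ_d = whittakerDepth d φ`: invariance under the rational points of
`Q_d ⊓ GL_{d+1} = P_{d+1}` (`d < n`). [folklore] -/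
theorem whittakerDepth_mul_left_of_mem {φ : GL (Fin n) (AdeleRing (𝓞 K) K) → ℂ}
    (hφK : ∀ (γ₀ : GL (Fin n) K) (x : GL (Fin n) (AdeleRing (𝓞 K) K)),
      φ (Matrix.GeneralLinearGroup.map (algebraMap K (AdeleRing (𝓞 K) K)) γ₀ * x) = φ x)
    {d : ℕ} (hd : d < n) {q₀ : GL (Fin n) K} (hq : q₀ ∈ tailUnipotent n K d) (hqc : q₀ ∈ cornerGL n K (d + 1))
    (x : GL (Fin n) (AdeleRing (𝓞 K) K)) :
    whittakerDepth d φ (Matrix.GeneralLinearGroup.map (algebraMap K (AdeleRing (𝓞 K) K)) q₀ * x) =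
      whittakerDepth d φ x := by
  unfold whittakerDepth
  refine whittakerIter_mul_left_of_mem hφK (n - 1 - d) q₀ ?_ ?_ x
  · have e : n - 1 - (n - 1 - d) = d := by omega
    rw [e]; exact hq
  · have e : n - (n - 1 - d) = d + 1 := by omega
    rw [e]; exact hqc

end Transform

end Literature.NumberTheory.Automorphic
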